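import Summits.BirchSwinnertonDyer.Rank1Residual.GaloisImage.KolyvaginDerivativeDescent
import Summits.BirchSwinnertonDyer.Rank1Residual.GaloisImage.CyclotomicLevelGenerators
import Summits.BirchSwinnertonDyer.Rank1Residual.GaloisImage.TateModuleEulerFactor
import Literature.NumberTheory.EllipticCurves.TateModuleContinuityProofs
import Literature.NumberTheory.EllipticCurves.TateModuleFreeProofs
import HarnessLib

/-!
# Kolyvagin's derivative classes of an Euler system for `T_p E` over the cyclotomic levels of `ℚ`
# (the `E/ℚ`-reading of THEOREM A3 of row T-DER, all choices discharged by name)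
# (cell `b2b-bsdres`, team n1011, seat p11 GEN 7, OWNERS row T-DER = skel/T-DER.md; file F5)

HONEST FRAMING (cell `b2b-bsdres`, run/shared/lean/b2b/bsd-rank1-residual/, verbatim in every
file): the goal of the cell is to DELETE the COMBINATION-SHAPED residual classes of the
Birch–Swinnerton-Dyer formula for ALL analytic-rank `≤ 1` elliptic curves over `ℚ` — "full BSD
formula for every rank `≤ 1` curve in class `C`" assembled STRICTLY from published theorems — so
that the rank-`≤ 1` remainder becomes exactly the CONSTRUCTION-SHAPED classes, which are TYPED
(missing-input `Prop`s), NOT attempted. This is not "finishing BSD". Team n1011 (N10 / N11, the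
additive block X4 ∧ `p = 3`): research route on the CONSTRUCTION-SHAPED class X4; no claim beyond the
stated classes; nothing is booked. TOOL theorem (no definition, no named fact, no `sorry`): the
`ℚ`-specialisation of the derivative construction; NO Euler system is asserted to exist (it is the
hypothesis `hc`), NO Selmer condition is claimed (THEOREM B), no END / record / flag text changes.

## What

For an elliptic curve `E/ℚ` (globally minimal model `W`), a prime `p`, a finite set `S` of places
and an Euler system `c` for the Tate module `T = T_p E` (`W.tateGaloisRep p`) over the cyclotomic
levels `cyclotomicLevelsRat p S` (the tower `ℚ(μ_{p^k ℓ₁⋯ℓ_s})`, tree `CyclotomicLevels`); a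
coefficient map `red : T ⟶ T'` to a `ℤ_p[Γ_ℚ]`-module `T'` killed by `p^k`; and a level
`r = {ℓ₁, …, ℓ_s}` of usable places all of which are KOLYVAGIN PRIMES of level `k ≥ 1`
(`Kato.IsKolyvaginPrime W p k ℓ`: `ℓ ∤ Np`, `ℓ ≡ 1`, `a_ℓ ≡ ℓ + 1 (mod p^k)`) with
`(T')^{Gal(ℚ̄/ℚ(μ_r))} = 0` (`h0`):  **there are generators `σ_ℓ` of `Gal(ℚ(μ_ℓ)/ℚ)` inside
`Gal(ℚ̄/ℚ(μ_q))` (`q ≠ ℓ`) and a UNIQUE class `κ_r ∈ H¹(ℚ, T')` restricting on `Gal(ℚ̄/ℚ(μ_r))` to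
Kolyvagin's derivative `D_r (red_* c_{0,r})`, `D_r = ∏_{ℓ∈r} Σ_{j<ℓ-1} j σ_ℓ^j`**
(`Rat.exists_sigma_existsUnique_res_eq_deriv_tate`).  Every choice of THEOREM A3
(`Derivative.existsUnique_res_eq_deriv`) is discharged BY NAME: the generators and their
transversal / generation properties by `CyclotomicLevel.Rat.exists_sigma_cyclotomicLevelsRat`
(n1011-p13, T-DER-INST p301627), the Frobenii by `CyclotomicLevel.exists_frobenius`, the
ramification of `ℚ(μ_ℓ)` at odd `ℓ` by
`CyclotomicLevel.Rat.not_subgroupIsUnramifiedAt_cyclotomicLevelsRat_level_insert`, and the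
`ℓ ∈ 𝒫_M` binders `M ∣ ℓ − 1`, `M ∣ P_ℓ(1)` by
`CyclotomicLevel.Rat.natCast_sub_one_smul_eq_zero_of_isKolyvaginPrime` /
`CyclotomicLevel.Rat.eval_one_rubinEulerFactor_galoisRepTate_smul_eq_zero` (n1011-p13, K1 p302588:
Rubin's `P(Fr⁻¹ | T_pE*; X) = 1 − (a_ℓ/ℓ)X + X²/ℓ`).  The only remaining hypotheses are the Euler
system `hc`, the torsion level `hM`, the Kolyvagin-prime certificate `hr` and `h0` (for
`T' = E[p]`-type coefficients under `Irr(E[p])`: the tree's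
`geomTorsion_eq_zero_of_commutator_fixed_of_irreducible`, p252010).

References: K. Rubin, *Euler Systems* (2000), Def. 4.4.1, Def. 4.4.4, Lemma 4.4.2;
B. Mazur, K. Rubin, *Kolyvagin systems* (2004), App. A (32).
-/

noncomputable section

open CategoryTheory Function Finset Polynomial Field IsDedekindDomain
open scoped NumberField Classical
open Literature.NumberTheory.GaloisRepresentations Literature.NumberTheory.EllipticCurves
open Summit.BirchSwinnertonDyer.Rank1Residual.GaloisImage.CyclotomicLevel

universe u

namespace Summit.BirchSwinnertonDyer.Rank1Residual.GaloisImage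

namespace Derivative

namespace Rat

variable (W : WeierstrassCurve ℚ) [W.IsElliptic] [W.IsGloballyMinimal] (p : ℕ) [Fact p.Prime]

omit [W.IsElliptic] in
/-- A Kolyvagin prime of level `k ≥ 1` is odd (`2 ≡ 1 (mod p^k)` is impossible). [folklore] -/
theorem ne_two_of_isKolyvaginPrime {k : ℕ} (hk : 0 < k) {ℓ : ℕ} (hℓ : Kato.IsKolyvaginPrime W p k ℓ) :
    ℓ ≠ 2 := by
  rintro rfl
  have h1 : 2 ≡ 1 [MOD p ^ k] := hℓ.2.2.1
  have hpk : 2 ≤ p ^ k := by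
    calc 2 ≤ p := (Fact.out : p.Prime).two_le
      _ = p ^ 1 := (pow_one p).symm
      _ ≤ p ^ k := Nat.pow_le_pow_right (Fact.out : p.Prime).pos hk
  have hdvd : p ^ k ∣ 2 - 1 := (Nat.modEq_iff_dvd' (by norm_num)).mp h1.symm
  have : p ^ k ≤ 1 := Nat.le_of_dvd (by norm_num) hdvd
  omega

/-- **Kolyvagin's derivative classes for `T_p E` over the cyclotomic levels of `ℚ`** (the
`E/ℚ`-reading of THEOREM A3, all choices discharged by name — see the module docstring): for an
Euler system `c` of `T_p E` over `cyclotomicLevelsRat p S`, a coefficient map `red` to `T'` killed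
by `p^k` (`k ≥ 1`), a level `r` of Kolyvagin primes of level `k`, and `(T')^{Gal(ℚ̄/ℚ(μ_r))} = 0`,
there are `σ_ℓ ∈ Γ_ℚ` (`ℓ ∈ r`), each fixing `μ_m` for `m` prime to `ℓ` and mapping to a generator of
`Gal(ℚ(μ_ℓ)/ℚ)`, and a UNIQUE `κ_r ∈ H¹(Γ_ℚ, T')` with
`res_{Gal(ℚ̄/ℚ(μ_r))} κ_r = (∏_{ℓ∈r} Σ_{j<ℓ-1} j σ_ℓ^j) (red_* c_{0,r})`.  The three instance
arguments on `T_p E` are the tree's `W.module_free_tateModule_holds p`,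
`W.module_finite_tateModule_holds p` and `TateModule.continuousSMul_padicInt` (supply with `haveI`).
[cite: Rubin2000, Def. 4.4.4 and Lemma 4.4.2] -/
theorem exists_sigma_existsUnique_res_eq_deriv_tate
    [Module.Free ℤ_[p] (W.tateModule p)] [Module.Finite ℤ_[p] (W.tateModule p)]
    [ContinuousSMul ℤ_[p] (W.tateModule p)]
    (S : Set (HeightOneSpectrum (𝓞 ℚ))) {k : ℕ} (hk : 0 < k)
    {c : ∀ (i : ℕ) (r : (cyclotomicLevelsRat p S).Ideals),
      H1 (W.tateGaloisRep p (W.continuous_galoisRepTate_holds p)) ((cyclotomicLevelsRat p S).level i r.1)}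
    (hc : IsEulerSystem (cyclotomicLevelsRat p S)
      (W.tateGaloisRep p (W.continuous_galoisRepTate_holds p)) p c)
    {M' : Type} [AddCommGroup M'] [Module ℤ_[p] M'] [TopologicalSpace M'] [IsTopologicalAddGroup M']
    [ContinuousSMul ℤ_[p] M'] {T' : GaloisRep ℚ ℤ_[p] M'}
    (red : (W.tateGaloisRep p (W.continuous_galoisRepTate_holds p)).toTopRep ⟶ T'.toTopRep)
    (hM : ∀ m : M', ((p : ℤ_[p]) ^ k) • m = 0)
    (r : (cyclotomicLevelsRat p S).Ideals)
    (hr : ∀ ℓ ∈ r.1, Kato.IsKolyvaginPrime W p k ((Rat.HeightOneSpectrum.primesEquiv ℓ : Nat.Primes) : ℕ))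
    (h0 : ∀ v : T'.toTopRep, (∀ u : (cyclotomicLevelsRat p S).level ⊥ r.1,
      T'.toTopRep.ρ (u : absoluteGaloisGroup ℚ) v = v) → v = 0) :
    ∃ σ : HeightOneSpectrum (𝓞 ℚ) → absoluteGaloisGroup ℚ,
      (∀ ℓ ∈ r.1, ∀ m : ℕ, (((Rat.HeightOneSpectrum.primesEquiv ℓ : Nat.Primes) : ℕ)).Coprime m →
        σ ℓ ∈ rootsOfUnityFixer ℚ m) ∧
      (∀ ℓ ∈ r.1, ∀ g : absoluteGaloisGroup ℚ,
        ∃ j < ((Rat.HeightOneSpectrum.primesEquiv ℓ : Nat.Primes) : ℕ) - 1,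
          (σ ℓ ^ j)⁻¹ * g ∈ (cyclotomicLevelsRat p S).tameLevel ℓ) ∧
      ∃ comm, ∃! κ : continuousCohomology 1 T'.toTopRep,
        resSubgroup T'.toTopRep ((cyclotomicLevelsRat p S).level ⊥ r.1) 1 κ =
          (r.1.noncommProd (fun ℓ => ∑ j ∈ range (((Rat.HeightOneSpectrum.primesEquiv ℓ : Nat.Primes)
              : ℕ) - 1), (j : Module.End ℤ_[p] (continuousCohomology 1
              (subgroupRep T'.toTopRep ((cyclotomicLevelsRat p S).level ⊥ r.1)))) *
            (conjMap T'.toTopRep ((cyclotomicLevelsRat p S).level ⊥ r.1) (σ ℓ) 1).hom.toLinearMap ^ j)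
            comm)
          (ContinuousCohomology.map (ContinuousMonoidHom.id _)
            (X := subgroupRep (W.tateGaloisRep p (W.continuous_galoisRepTate_holds p)).toTopRep
              ((cyclotomicLevelsRat p S).level ⊥ r.1))
            (Y := subgroupRep T'.toTopRep ((cyclotomicLevelsRat p S).level ⊥ r.1))
            ((TopRep.resFunctor ((cyclotomicLevelsRat p S).level ⊥ r.1).subtype).map red) 1
            (c ⊥ r)) := by
  -- the chosen generators (T-DER-INST, p13) and Frobenii
  obtain ⟨σ, hσ, hcov, hinj, hcop, -⟩ := CyclotomicLevel.Rat.exists_sigma_cyclotomicLevelsRat p S r.1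
  obtain ⟨Fr, hFr⟩ := CyclotomicLevel.exists_frobenius ℚ
  refine ⟨σ, hcop, hcov, pairwise_commute_deriv ⊥ r.1 σ _, ?_⟩
  -- the `ℓ ∈ 𝒫_M` binders (K1, p13) and the ramification clause
  have h2 : ∀ ℓ ∈ r.1, ((Rat.HeightOneSpectrum.primesEquiv ℓ : Nat.Primes) : ℕ) ≠ 2 :=
    fun ℓ hℓ => ne_two_of_isKolyvaginPrime W p hk (hr ℓ hℓ)
  have hram : ∀ ℓ ∈ r.1, ∀ s ⊆ r.1, ℓ ∉ s →
      ¬ SubgroupIsUnramifiedAt ℚ ((cyclotomicLevelsRat p S).level ⊥ (insert ℓ s)) ℓ :=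
    fun ℓ hℓ s _ _ =>
      CyclotomicLevel.Rat.not_subgroupIsUnramifiedAt_cyclotomicLevelsRat_level_insert p S ⊥ (h2 ℓ hℓ) s
  have hM₁ : ∀ ℓ ∈ r.1, ∀ v : M',
      ((((Rat.HeightOneSpectrum.primesEquiv ℓ : Nat.Primes) : ℕ) - 1 : ℕ) : ℤ_[p]) • v = 0 :=
    fun ℓ hℓ v => CyclotomicLevel.Rat.natCast_sub_one_smul_eq_zero_of_isKolyvaginPrime W hM (hr ℓ hℓ) v
  have hM₂ : ∀ ℓ ∈ r.1, ∀ v : M',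
      (rubinEulerFactor (W.tateGaloisRep p (W.continuous_galoisRepTate_holds p)).toRepresentation
        (cyclotomicCharacterToUnits ℚ p ℤ_[p]) (Fr ℓ)).eval 1 • v = 0 :=
    fun ℓ hℓ v =>
      CyclotomicLevel.Rat.eval_one_rubinEulerFactor_galoisRepTate_smul_eq_zero W hM (hr ℓ hℓ) (hFr ℓ) v
  exact existsUnique_res_eq_deriv hc red r σ _ Fr hσ hcov hinj (fun ℓ _ => hFr ℓ) hram hM₁ hM₂ _ h0

end Rat

end Derivative

end Summit.BirchSwinnertonDyer.Rank1Residual.GaloisImage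

end
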